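import Summits.QuantumAdvantage.AdviceFreeQNC0.WalkCoreMixed
import Summits.QuantumAdvantage.AdviceFreeQNC0.WalkCoreGenuineRow
import Summits.QuantumAdvantage.AdviceFreeQNC0.EliminationHardness
import HarnessLib

/-!
# Cell qa-qnc0 (rung F-Q1, route RingFrame, crux α): walk core — the LDMA chain and W2
# (`LDMAFam → WalkHardAll`); the equivalence `MixedHardPolylog ↔ WalkHardAll ↔ LDMAWalk ↔ LDMAFam`
# (planner qa-qnc0-p1 Sketch10 §22.2, ask P9)

Statements VERBATIM from `Sketch10.lean` §22.2 (`LDMAFamWith`, `LDMAFam`, `LDMAChain`,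
`LDMAFamSuffices`) and PROVED:

* `ldmaChain : LDMAChain` — `LDMAWith κ → LDMAWalkWith κ → LDMAFamWith κ` (a family row
  `u ↦ WIN_{Y u}(v)` is the parity of the selectors over the fixed live set, `hasDeg_parity`);
* **W2 `ldmaFam_suffices : LDMAFamSuffices`** (`LDMAFam → WalkHardAll`): at the balanced cut
  `n = L + L'` the genuine rows of label `r` are the win patterns of the induced family at charge
  `c + L + r` (W1 `genuineRow_isWalk`), so `LDMAFamWith κ` feeds `agree_ge_of_ldma_stakes`; Bob's
  budget `η₀·2^{L'}` is the THEOREM `elimHard`; `θ = 1 − κη₀`;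
* the corollaries `ldmaFam_of_mixedHardPolylog`, `walkHardAll_of_ldmaWalk`, and the equivalences
  `walkHardAll_iff_ldmaFam`, `walkHardAll_iff_ldmaWalk`, `mixedHardPolylog_iff_ldmaFam`:
  **the walk core of `stub_LDMA` is EXACTLY `WalkHardAll`-equivalent.**

WHAT THIS IS NOT: none of `WalkHardAll`, `MixedHardPolylog`, `LDMAFam`, `LDMAWalk` is proved here
(they are equivalent reformulations of the open walk-game hardness at polylog degree); E2 and E6
(`RingHardU → WalkHardAll`) are not here; nothing on α or the separation.
-/

noncomputable section

namespace Summit.QuantumAdvantage.AdviceFreeQNC0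

open Finset
open Literature.Computability.MetaComplexity Literature.Computability.MetaComplexity.Smolensky

/-! ### Vocabulary (verbatim from `Sketch10` §22.2) -/

/-- **`LDMAFamWith κ` — LDMA, walk core (family form = exactly what the chain consumes)**: for
every FAMILY `Y : u ↦ y'_u` of walk strategies on `L'` bits with both partial degrees `≤ D`, the
best-mixed-loss `u ↦ distFail D (WIN_{y'_u})` at a fixed charge puts mass `≥ κ` on every residue
class of `|u|`. -/
def LDMAFamWith (κ : ℝ) : Prop :=
  ∀ C : ℕ, ∃ L₀ : ℕ, ∀ L L' : ℕ, L₀ ≤ L → L₀ ≤ L' → ∀ D : ℕ, D ≤ (Nat.log 2 (min L L')) ^ C →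
    ∀ c' : ℕ, ∀ Y : (Fin L → Bool) → Fin (L' + 1) → (Fin L' → Bool) → Bool,
      (∀ g' v, HasDeg (fun u => Y u g' v) D) → (∀ u g', HasDeg (Y u g') D) → ∀ r : ℕ,
        κ * ((∑ u : Fin L → Bool, distFail D (ringWinU c' (Y u)) : ℕ) : ℝ) ≤
          ((∑ u ∈ cls L r, distFail D (ringWinU c' (Y u)) : ℕ) : ℝ)

/-- `LDMAFam := ∃ κ > 0, LDMAFamWith κ`. -/
def LDMAFam : Prop := ∃ κ : ℝ, 0 < κ ∧ LDMAFamWith κ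

/-- trivial inclusions: `LDMAWith κ → LDMAWalkWith κ → LDMAFamWith κ`. -/
def LDMAChain : Prop := ∀ κ : ℝ, (LDMAWith κ → LDMAWalkWith κ) ∧ (LDMAWalkWith κ → LDMAFamWith κ)

/-- **W2 — sufficiency**: `LDMAFam → WalkHardAll`. -/
def LDMAFamSuffices : Prop := LDMAFam → WalkHardAll

/-! ### The chain -/

/-- A family row `u ↦ WIN_{Y u}(v)` at fixed `v` has degree `≤ D` in `u`: it is the parity of the
selectors `u ↦ Y u g' v` over the live set `{g' : c' + g' + e_{g'}(v) ≢ 0}`, which is fixed. -/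
theorem hasDeg_ringWinU_col {L L' D : ℕ} (c' : ℕ)
    (Y : (Fin L → Bool) → Fin (L' + 1) → (Fin L' → Bool) → Bool)
    (hY : ∀ g' v, HasDeg (fun u => Y u g' v) D) (v : Fin L' → Bool) :
    HasDeg (fun u => ringWinU c' (Y u) v) D := by
  have hs : ∀ u : Fin L → Bool,
      (univ.filter fun g : Fin (L' + 1) => Y u g v = true ∧ (c' + g.val + walkExp v g.val) % 3 ≠ 0) =
        (univ.filter fun g : Fin (L' + 1) => (c' + g.val + walkExp v g.val) % 3 ≠ 0).filter
          fun g => Y u g v = true := by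
    intro u
    ext g
    simp only [mem_filter, mem_univ, true_and]
    exact and_comm
  have e : (fun u => ringWinU c' (Y u) v) = fun u =>
      decide (((univ.filter fun g : Fin (L' + 1) => (c' + g.val + walkExp v g.val) % 3 ≠ 0).filter
        fun g => (fun g u => Y u g v) g u = true).card % 2 = 1) := by
    funext u
    unfold ringWinU
    rw [hs u]
  rw [e]
  exact hasDeg_parity _ (fun g u => Y u g v) fun g _ => hY g v

/-- **`LDMAChain`.** -/
theorem ldmaChain : LDMAChain := by
  intro κ
  refine ⟨fun h C => ?_, fun h C => ?_⟩
  · obtain ⟨L₀, hL₀⟩ := h C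
    exact ⟨L₀, fun L L' hL hL' D hD _ Γ hΓ _ r => hL₀ L L' hL hL' D hD Γ hΓ r⟩
  · obtain ⟨L₀, hL₀⟩ := h C
    refine ⟨L₀, fun L L' hL hL' D hD c' Y hY1 hY2 r => ?_⟩
    exact hL₀ L L' hL hL' D hD c' (fun u v => ringWinU c' (Y u) v)
      (fun v => hasDeg_ringWinU_col c' Y hY1 v) (fun u => ⟨Y u, hY2 u, fun _ => rfl⟩) r

/-- `MixedHardPolylog → LDMAFam` (W3 and the chain). -/
theorem ldmaFam_of_mixedHardPolylog (h : MixedHardPolylog) : LDMAFam := by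
  obtain ⟨κ, hκ, hW⟩ := ldmaWalk_of_mixedHardPolylog h
  exact ⟨κ, hκ, (ldmaChain κ).2 hW⟩

/-! ### W2: `LDMAFam → WalkHardAll` -/

/-- Polylog bookkeeping at the balanced cut: `(log₂ (L + L'))^C ≤ (log₂ (min L L'))^{2C}` for
`4 ≤ L' ≤ L ≤ L' + 1`. -/
theorem log_pow_le_log_min_pow {L L' : ℕ} (C : ℕ) (h4 : 4 ≤ L') (hLL' : L' ≤ L) (hL : L ≤ L' + 1) :
    (Nat.log 2 (L + L')) ^ C ≤ (Nat.log 2 (min L L')) ^ (2 * C) := by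
  rw [min_eq_right hLL', pow_mul]
  apply Nat.pow_le_pow_left
  have hlt : L' < 2 ^ (Nat.log 2 L' + 1) := Nat.lt_pow_succ_log_self (by norm_num) L'
  have h1 : Nat.log 2 (L + L') < Nat.log 2 L' + 2 :=
    Nat.log_lt_of_lt_pow (by omega) (by rw [pow_succ]; omega)
  have h2 : 2 ≤ Nat.log 2 L' := Nat.le_log_of_pow_le (by norm_num) (by norm_num [h4])
  nlinarith

/-- **W2 `LDMAFamSuffices`: `LDMAFam → WalkHardAll`.** -/
theorem ldmaFam_suffices : LDMAFamSuffices := by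
  rintro ⟨κ, hκ, hF⟩
  obtain ⟨η₀, hη₀, hE⟩ := elimHard
  refine ⟨1 - κ * η₀, by nlinarith [mul_pos hκ hη₀], fun C => ?_⟩
  obtain ⟨L₀, hL₀⟩ := hF (2 * C)
  obtain ⟨nE, hnE⟩ := hE (2 * C)
  refine ⟨2 * (L₀ + nE + 4), fun n hn c y hy => ?_⟩
  obtain ⟨L, L', hLL', hLle, rfl⟩ : ∃ L L' : ℕ, L' ≤ L ∧ L ≤ L' + 1 ∧ n = L + L' :=
    ⟨n - n / 2, n / 2, by omega, by omega, by omega⟩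
  set D := (Nat.log 2 (L + L')) ^ C with hD
  have hDmin : D ≤ (Nat.log 2 (min L L')) ^ (2 * C) := log_pow_le_log_min_pow C (by omega) hLL' hLle
  have hDL' : D ≤ (Nat.log 2 L') ^ (2 * C) := by rwa [min_eq_right hLL'] at hDmin
  -- Bob's minimum fail weight: the THEOREM `elimHard`
  have hw : η₀ * (2 : ℝ) ^ L' ≤ (distFail D (fun _ : Fin L' → Bool => false) : ℝ) :=
    le_distFail_zero_of fun a b ha hb dec =>
      hnE L' (by omega) a b (lowDeg_mono hDL' ha) (lowDeg_mono hDL' hb) dec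
  -- LDMA for the genuine rows, from the family form at charge `c + L + r` (W1)
  have hLDMA : ∀ r : Fin 3, ∀ s : ℕ,
      κ * ((∑ u : Fin L → Bool, distFail D (stakesRow (stakeA c y) (stakeB c y) r u) : ℕ) : ℝ) ≤
        ((∑ u ∈ univ.filter (fun u : Fin L → Bool => wt u % 3 = s % 3),
          distFail D (stakesRow (stakeA c y) (stakeB c y) r u) : ℕ) : ℝ) := by
    intro r s
    have hrow : ∀ u, stakesRow (stakeA c y) (stakeB c y) r u =
        ringWinU (c + L + r.val) (induced y u) := by
      intro u
      funext v
      exact (genuineRow_eq_stakesRow c y r u v).symm.trans (genuineRow_isWalk L L' c y r u v)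
    simp only [hrow]
    exact hL₀ L L' (by omega) (by omega) D hDmin (c + L + r.val) (induced y)
      (fun g' v => hasDeg_append_left v (hy _)) (fun u g' => hasDeg_induced y hy u g') s
  have hagree := agree_ge_of_ldma_stakes hκ.le (stakeA c y) (stakeB c y) hLDMA hw _ _
    (win1_eq_stakes c y) (isElimWin_win0 c (crossDeg_F0 y hy))
  have htot : (crossWinCount c (F0 y) (F1 y) : ℝ) +
      (agreeCountR (win1 c (F1 y)) (win0 c (F0 y)) : ℝ) = (2 : ℝ) ^ (L + L') := by
    exact_mod_cast crossWinCount_add_agree c (F0 y) (F1 y)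
  rw [card_ringWinU_eq]
  linarith

/-! ### The equivalences -/

/-- `LDMAWalk → WalkHardAll`. -/
theorem walkHardAll_of_ldmaWalk (h : LDMAWalk) : WalkHardAll := by
  obtain ⟨κ, hκ, hW⟩ := h
  exact ldmaFam_suffices ⟨κ, hκ, (ldmaChain κ).2 hW⟩

/-- **`WalkHardAll ↔ LDMAFam`.** -/
theorem walkHardAll_iff_ldmaFam : WalkHardAll ↔ LDMAFam :=
  ⟨fun h => ldmaFam_of_mixedHardPolylog (mixedHardPolylog_iff_walkHardAll.2 h), ldmaFam_suffices⟩

/-- **`WalkHardAll ↔ LDMAWalk`.** -/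
theorem walkHardAll_iff_ldmaWalk : WalkHardAll ↔ LDMAWalk :=
  ⟨fun h => ldmaWalk_of_mixedHardPolylog (mixedHardPolylog_iff_walkHardAll.2 h),
    walkHardAll_of_ldmaWalk⟩

/-- **`MixedHardPolylog ↔ LDMAFam`.** -/
theorem mixedHardPolylog_iff_ldmaFam : MixedHardPolylog ↔ LDMAFam :=
  mixedHardPolylog_iff_walkHardAll.trans walkHardAll_iff_ldmaFam

end Summit.QuantumAdvantage.AdviceFreeQNC0

end
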